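/-
Copyright (c) 2026 the pub-hodgecm-mathlib formalisation cell (harness21).  Prover seat hodgecm-mathlib-K2Liu-p10 (g0), Track B «K2-LIT»,
#184♮ = hLiu418 = `stmt-HodgeConjecture-24832`; LEAD F0P6-plan (g12) RE-DEAL 2026-09-04T06:46:52Z ∕ 06:48:17Z «Hol-1», SIGS-RoadI-v3 §Hol
row H1-B (K2E5-plan (g5)).  THEOREMS ONLY (no `def`, no `instance`, no named-fact hypothesis, no `sorry`).
-/
import Summits.HodgeConjecture.HodgeConjecture.Theorems.K2LiuHermitianTubeCocycle
import Literature.NumberTheory.Automorphic.ResGLnHermitianConeOpen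
import Literature.NumberTheory.Weil1964.ArchUnitaryBallTransitive
import Mathlib.Analysis.Convex.Basic
import HarnessLib

/-!
# Crux `HLiu418`, Road I, organ Hol-1 (H1-B): the hermitian tube `ℌ_n` — openness, convexity, transitivity of `P_Δ`,
# the Iwasawa-type factorisation `g = u(X) m(R) · u`, `u ∈ Stab(i·1)`, and continuity of the action

Cell `hodgecm-mathlib`, crux item hLiu418 = `stmt-HodgeConjecture-24832` (helper lane, count-neutral).  Sequel of (H1-A)
★ `K2LiuHermitianTubeCocycle` (block relations, key identity, `isUnit_denom`, `posDef_im_moeb`, cocycle, Siegel-parabolic formulas);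
objects as there: the tube is ★ `KudlaRapoport2013.Sec11Sec12MainTheorem.hermUpperHalfSpace n = {Z | ((2i)⁻¹(Z − Zᴴ)).PosDef}`, the action is
★ `SiegelUpperHalfSpace.moeb`, the group is `{P | Pᴴ J P = J}` (`= unitaryGroupOfForm (starRingEnd ℂ) (I • J)`, `J = Matrix.J l ℂ`).

CONTENTS.  §1 `hermUpperHalfSpace n` is OPEN (positivity of a hermitian matrix depending continuously on `Z`, ★ `ResGLnCone.
isOpen_setOf_posDef_comp`) and CONVEX (`Im` is `ℝ`-affine, the positive cone is convex), also for the product over places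
`Set.pi univ (fun _ => hermUpperHalfSpace n)` — these are Hol-2a's `hU ∕ hUc`; §2 TRANSITIVITY through the Siegel parabolic: for
`Z ∈ ℌ`, with `X = Re Z`, `R = (Im Z)^{1/2}` (Mathlib `CFC.sqrt`, ★ `Weil1964.UnitaryBall.sqrt_mul_sqrt_of_posDef`), the element
`g_Z := u(X) m(R) = (1 X; 0 1)(R 0; 0 R⁻¹)` lies in `U(J) ∩ P_Δ` and `g_Z · (i1) = Z`, with automorphy matrix `denom g_Z (i1) = R⁻¹`;
§3 the factorisation `g = g_{g·i1} · u` with `u · i1 = i1` for every `g ∈ U(J)` (so `U(J) = P_Δ · Stab(i1)`), and the stabiliser equation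
`g · i1 = i1 ↔ iA + B = −C + iD`; §4 continuity: `Z ↦ denom P Z`, `Z ↦ (denom P Z).det` are continuous and `Z ↦ moeb P Z` is continuous on
`ℌ` for `P ∈ U(J)`.
Sources: [Shimura1997, §6 (Case UT)], [KudlaRapoport2013, §7]; proofs elementary.
HONEST LABEL.  Helper lemmas, count-neutral; `HC_CM` is proved only modulo the 7 printed citations (2 remaining named inputs:
hLiu418 = `stmt-HodgeConjecture-24832`, h413 = `stmt-HodgeConjecture-24833`) until rung 0 closes.
-/

set_option autoImplicit false
set_option linter.dupNamespace false -- the mandated namespace repeats `HodgeConjecture.HodgeConjecture`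

namespace Summit.HodgeConjecture.HodgeConjecture.Cruxes.HLiu418.K2LiuHermitianTubeAction

open Matrix Complex Set
open scoped MatrixGroups ComplexOrder MatrixOrder Topology
open Literature.NumberTheory.ModularForms.SiegelUpperHalfSpace (num denom moeb num_def denom_def moeb_def
  num_fromBlocks denom_fromBlocks moeb_mul denom_mul_eq moeb_mul_denom moeb_one)
open Literature.AlgebraicGeometry.ShimuraVarieties.KudlaRapoport2013.Sec11Sec12MainTheorem (hermUpperHalfSpace)
open Literature.NumberTheory.Weil1964.UnitaryBall (sqrt_mul_sqrt_of_posDef conjTranspose_sqrt isUnit_det_sqrt_of_posDef)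
open K2LiuHermitianTubeCocycle

variable {l : Type*} [Fintype l] [DecidableEq l]

/-! ## 1. Openness and convexity -/

omit [Fintype l] [DecidableEq l] in
/-- `Z ↦ Im Z = (2i)⁻¹(Z − Zᴴ)` is continuous. [cite: KudlaRapoport2013, §7 (p. 31)] -/
theorem continuous_im : Continuous fun Z : Matrix l l ℂ => (2 * I)⁻¹ • (Z - Zᴴ) := by
  have h1 : Continuous fun Z : Matrix l l ℂ => Z - Zᴴ := continuous_id.sub continuous_id.matrix_conjTranspose
  exact h1.const_smul ((2 * I)⁻¹ : ℂ)

omit [DecidableEq l] in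
/-- **The tube `{Im Z ≻ 0}` is open** in `M_l(ℂ)`. [cite: KudlaRapoport2013, §7 (p. 31)] -/
theorem isOpen_setOf_posDef_im : IsOpen {Z : Matrix l l ℂ | ((2 * I)⁻¹ • (Z - Zᴴ)).PosDef} :=
  Literature.NumberTheory.Automorphic.ResGLnCone.isOpen_setOf_posDef_comp continuous_im isHermitian_im

/-- **`hermUpperHalfSpace n` is open.** [cite: KudlaRapoport2013, §7 (p. 31)] -/
theorem isOpen_hermUpperHalfSpace (n : ℕ) : IsOpen (hermUpperHalfSpace n) :=
  isOpen_setOf_posDef_im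

omit [Fintype l] [DecidableEq l] in
/-- A real scalar acts on complex matrices through `ℝ → ℂ`. [folklore] -/
theorem real_smul_eq_coe_smul (a : ℝ) (Z : Matrix l l ℂ) : a • Z = (a : ℂ) • Z :=
  (algebraMap_smul ℂ a Z).symm

omit [Fintype l] [DecidableEq l] in
/-- `Im (a•Z + b•W) = a • Im Z + b • Im W` for real `a, b` (`Im` is `ℝ`-linear). [cite: KudlaRapoport2013, §7 (p. 31)] -/
theorem im_real_combo (a b : ℝ) (Z W : Matrix l l ℂ) :
    (2 * I)⁻¹ • ((a • Z + b • W) - (a • Z + b • W)ᴴ) =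
      (a : ℂ) • ((2 * I)⁻¹ • (Z - Zᴴ)) + (b : ℂ) • ((2 * I)⁻¹ • (W - Wᴴ)) := by
  rw [real_smul_eq_coe_smul, real_smul_eq_coe_smul, conjTranspose_add, conjTranspose_smul, conjTranspose_smul,
    star_def, conj_ofReal, conj_ofReal, smul_comm (a : ℂ) (2 * I)⁻¹, smul_comm (b : ℂ) (2 * I)⁻¹, ← smul_add]
  congr 1
  rw [smul_sub, smul_sub]
  abel

omit [Fintype l] [DecidableEq l] in
/-- **The tube `{Im Z ≻ 0}` is convex.** [cite: KudlaRapoport2013, §7 (p. 31)] -/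
theorem convex_setOf_posDef_im : Convex ℝ {Z : Matrix l l ℂ | ((2 * I)⁻¹ • (Z - Zᴴ)).PosDef} := by
  intro Z hZ W hW a b ha hb hab
  simp only [mem_setOf_eq] at hZ hW ⊢
  rw [im_real_combo]
  rcases ha.eq_or_lt with rfl | ha'
  · rw [zero_add] at hab
    rw [hab, ofReal_zero, zero_smul, zero_add, ofReal_one, one_smul]
    exact hW
  · have hac : (0 : ℂ) < (a : ℂ) := zero_lt_real.2 ha'
    have hbc : (0 : ℂ) ≤ (b : ℂ) := zero_le_real.2 hb
    exact (hZ.smul hac).add_posSemidef (hW.posSemidef.smul hbc)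

/-- **`hermUpperHalfSpace n` is convex.** [cite: KudlaRapoport2013, §7 (p. 31)] -/
theorem convex_hermUpperHalfSpace (n : ℕ) : Convex ℝ (hermUpperHalfSpace n) :=
  convex_setOf_posDef_im

/-- The product of tubes over a finite set of places is open. [cite: KudlaRapoport2013, §7 (p. 31)] -/
theorem isOpen_pi_hermUpperHalfSpace {σ : Type*} [Finite σ] (n : ℕ) :
    IsOpen (Set.pi univ fun _ : σ => hermUpperHalfSpace n) :=
  isOpen_set_pi finite_univ fun _ _ => isOpen_hermUpperHalfSpace n

/-- The product of tubes is convex. [cite: KudlaRapoport2013, §7 (p. 31)] -/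
theorem convex_pi_hermUpperHalfSpace {σ : Type*} (n : ℕ) :
    Convex ℝ (Set.pi univ fun _ : σ => hermUpperHalfSpace n) :=
  convex_pi fun _ _ => convex_hermUpperHalfSpace n

/-! ## 2. Transitivity through the Siegel parabolic: `g_Z = u(Re Z) m((Im Z)^{1/2})` -/

/-- `g_Z = u(X) m(R) ∈ U(J)` for `X` hermitian and `R` hermitian invertible. [cite: Shimura1997, §6.4] -/
theorem transl_mul_levi_mem {X R : Matrix l l ℂ} (hX : Xᴴ = X) (hR : Rᴴ = R) (hRu : IsUnit R.det) :
    (fromBlocks 1 X 0 1 * fromBlocks R 0 0 R⁻¹ : Matrix (l ⊕ l) (l ⊕ l) ℂ)ᴴ * Matrix.J l ℂ *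
        (fromBlocks 1 X 0 1 * fromBlocks R 0 0 R⁻¹) = Matrix.J l ℂ := by
  refine mul_mem_UJ ((transl_mem_iff X).2 hX) ((levi_mem_iff R R⁻¹).2 ?_)
  rw [hR, mul_nonsing_inv R hRu]

/-- `g_Z = u(X) m(R)` lies in the Siegel parabolic: its lower-left block vanishes. [cite: Shimura1997, §6.4] -/
theorem toBlocks₂₁_transl_mul_levi (X R : Matrix l l ℂ) :
    (fromBlocks 1 X 0 1 * fromBlocks R 0 0 R⁻¹ : Matrix (l ⊕ l) (l ⊕ l) ℂ).toBlocks₂₁ = 0 := by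
  rw [fromBlocks_multiply, toBlocks_fromBlocks₂₁, Matrix.zero_mul, Matrix.mul_zero, add_zero]

/-- `g_Z = u(X) m(R) = (R, X R⁻¹; 0, R⁻¹)`. [cite: Shimura1997, §6.4] -/
theorem transl_mul_levi_eq (X R : Matrix l l ℂ) :
    (fromBlocks 1 X 0 1 * fromBlocks R 0 0 R⁻¹ : Matrix (l ⊕ l) (l ⊕ l) ℂ) = fromBlocks R (X * R⁻¹) 0 R⁻¹ := by
  rw [fromBlocks_multiply]
  simp only [Matrix.one_mul, Matrix.mul_zero, Matrix.zero_mul, add_zero, zero_add]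

/-- The automorphy matrix of `g_Z` at any point is `R⁻¹`. [cite: Shimura1997, §6.4] -/
theorem denom_transl_mul_levi (X R W : Matrix l l ℂ) :
    denom (fromBlocks 1 X 0 1 * fromBlocks R 0 0 R⁻¹) W = R⁻¹ := by
  rw [transl_mul_levi_eq, denom_fromBlocks, Matrix.zero_mul, zero_add]

/-- **Transitivity**: every `Z` with `Im Z ≻ 0` is `g_Z · (i1)` with `g_Z = u(Re Z) m((Im Z)^{1/2}) ∈ U(J) ∩ P_Δ`; recorded with the
data `X = Re Z = 2⁻¹(Z + Zᴴ)` and `R = CFC.sqrt (Im Z)` (hermitian, `R² = Im Z`, `det R ≠ 0`). [cite: Shimura1997, §6.4] -/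
theorem moeb_section_I {Z : Matrix l l ℂ} (hZ : ((2 * I)⁻¹ • (Z - Zᴴ)).PosDef) :
    moeb (fromBlocks 1 ((2 : ℂ)⁻¹ • (Z + Zᴴ)) 0 1 *
        fromBlocks (CFC.sqrt ((2 * I)⁻¹ • (Z - Zᴴ))) 0 0 (CFC.sqrt ((2 * I)⁻¹ • (Z - Zᴴ)))⁻¹) (I • 1) = Z := by
  rw [moeb_transl_mul_levi_I (isUnit_det_sqrt_of_posDef hZ), sqrt_mul_sqrt_of_posDef hZ, re_add_I_smul_im]

/-- The section `g_Z` is in `U(J)`. [cite: Shimura1997, §6.4] -/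
theorem section_mem {Z : Matrix l l ℂ} (hZ : ((2 * I)⁻¹ • (Z - Zᴴ)).PosDef) :
    (fromBlocks 1 ((2 : ℂ)⁻¹ • (Z + Zᴴ)) 0 1 *
        fromBlocks (CFC.sqrt ((2 * I)⁻¹ • (Z - Zᴴ))) 0 0 (CFC.sqrt ((2 * I)⁻¹ • (Z - Zᴴ)))⁻¹ :
          Matrix (l ⊕ l) (l ⊕ l) ℂ)ᴴ * Matrix.J l ℂ *
      (fromBlocks 1 ((2 : ℂ)⁻¹ • (Z + Zᴴ)) 0 1 *
        fromBlocks (CFC.sqrt ((2 * I)⁻¹ • (Z - Zᴴ))) 0 0 (CFC.sqrt ((2 * I)⁻¹ • (Z - Zᴴ)))⁻¹) = Matrix.J l ℂ :=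
  transl_mul_levi_mem (isHermitian_re Z) (conjTranspose_sqrt _) (isUnit_det_sqrt_of_posDef hZ)

/-- **Transitivity, existential form**: `∃ X R`, `X`, `R` hermitian, `det R ≠ 0`, with `u(X) m(R) ∈ U(J)` and
`u(X) m(R) · i1 = Z`. [cite: Shimura1997, §6.4] -/
theorem exists_transl_levi_moeb_I_eq {Z : Matrix l l ℂ} (hZ : ((2 * I)⁻¹ • (Z - Zᴴ)).PosDef) :
    ∃ X R : Matrix l l ℂ, Xᴴ = X ∧ Rᴴ = R ∧ IsUnit R.det ∧
      (fromBlocks 1 X 0 1 * fromBlocks R 0 0 R⁻¹ : Matrix (l ⊕ l) (l ⊕ l) ℂ)ᴴ * Matrix.J l ℂ *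
          (fromBlocks 1 X 0 1 * fromBlocks R 0 0 R⁻¹) = Matrix.J l ℂ ∧
        moeb (fromBlocks 1 X 0 1 * fromBlocks R 0 0 R⁻¹) (I • 1) = Z :=
  ⟨(2 : ℂ)⁻¹ • (Z + Zᴴ), CFC.sqrt ((2 * I)⁻¹ • (Z - Zᴴ)), isHermitian_re Z, conjTranspose_sqrt _,
    isUnit_det_sqrt_of_posDef hZ, section_mem hZ, moeb_section_I hZ⟩

/-- Transitivity on `hermUpperHalfSpace n`: every point is `g · (i1)` for some `g ∈ U(J)` with `g₂₁ = 0`.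
[cite: KudlaRapoport2013, §7 (p. 31)] -/
theorem exists_siegel_moeb_I_eq {n : ℕ} {Z : Matrix (Fin n) (Fin n) ℂ} (hZ : Z ∈ hermUpperHalfSpace n) :
    ∃ g : Matrix (Fin n ⊕ Fin n) (Fin n ⊕ Fin n) ℂ, gᴴ * Matrix.J (Fin n) ℂ * g = Matrix.J (Fin n) ℂ ∧
      g.toBlocks₂₁ = 0 ∧ moeb g (I • 1) = Z := by
  obtain ⟨X, R, -, -, -, hmem, hZ'⟩ := exists_transl_levi_moeb_I_eq hZ
  exact ⟨_, hmem, toBlocks₂₁_transl_mul_levi X R, hZ'⟩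

/-! ## 3. `U(J) = P_Δ · Stab(i1)` and the stabiliser equation -/

/-- The inverse of `g_Z = u(X) m(R)` is `m(R⁻¹) u(−X)`-shaped: `(m(R⁻¹,R) u(−X)) (u(X) m(R,R⁻¹)) = 1` for invertible `R`.
[cite: Shimura1997, §6.4] -/
theorem levi_inv_mul_transl_neg_mul {X R : Matrix l l ℂ} (hRu : IsUnit R.det) :
    (fromBlocks R⁻¹ 0 0 R * fromBlocks 1 (-X) 0 1 : Matrix (l ⊕ l) (l ⊕ l) ℂ) *
        (fromBlocks 1 X 0 1 * fromBlocks R 0 0 R⁻¹) = 1 := by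
  rw [← Matrix.mul_assoc, Matrix.mul_assoc (fromBlocks R⁻¹ 0 0 R), transl_mul_transl, neg_add_cancel,
    fromBlocks_multiply, fromBlocks_multiply]
  simp only [Matrix.mul_zero, Matrix.zero_mul, Matrix.mul_one, add_zero, zero_add, nonsing_inv_mul R hRu,
    mul_nonsing_inv R hRu, fromBlocks_one]

/-- `u(X) m(R,R⁻¹) (m(R⁻¹,R) u(−X)) = 1`. [cite: Shimura1997, §6.4] -/
theorem transl_mul_levi_mul_inv {X R : Matrix l l ℂ} (hRu : IsUnit R.det) :
    (fromBlocks 1 X 0 1 * fromBlocks R 0 0 R⁻¹ : Matrix (l ⊕ l) (l ⊕ l) ℂ) *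
        (fromBlocks R⁻¹ 0 0 R * fromBlocks 1 (-X) 0 1) = 1 :=
  mul_eq_one_comm.1 (levi_inv_mul_transl_neg_mul hRu)

/-- `m(R⁻¹,R) u(−X) · (X + i R²) = i1`. [cite: Shimura1997, §6.4] -/
theorem moeb_inv_section {X R : Matrix l l ℂ} (hRu : IsUnit R.det) :
    moeb (fromBlocks R⁻¹ 0 0 R * fromBlocks 1 (-X) 0 1) (X + I • (R * R)) = I • 1 := by
  have hd : IsUnit (denom (fromBlocks 1 (-X) 0 1) (X + I • (R * R))).det := by
    rw [denom_transl, det_one]; exact isUnit_one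
  rw [moeb_mul hd, moeb_transl, add_neg_cancel_comm, moeb_levi, Matrix.mul_smul, ← Matrix.mul_assoc,
    nonsing_inv_mul R hRu, Matrix.one_mul, Matrix.smul_mul, mul_nonsing_inv R hRu]

/-- **`U(J) = P_Δ · Stab(i1)`**: every `g ∈ U(J)` factors as `g = (u(X) m(R)) · u` with `X, R` hermitian, `det R ≠ 0`, `u ∈ U(J)` and
`u · i1 = i1`. [cite: Shimura1997, §6.4] -/
theorem exists_transl_levi_mul_stabilizer {g : Matrix (l ⊕ l) (l ⊕ l) ℂ} (hg : gᴴ * Matrix.J l ℂ * g = Matrix.J l ℂ) :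
    ∃ X R : Matrix l l ℂ, ∃ u : Matrix (l ⊕ l) (l ⊕ l) ℂ, Xᴴ = X ∧ Rᴴ = R ∧ IsUnit R.det ∧
      uᴴ * Matrix.J l ℂ * u = Matrix.J l ℂ ∧ moeb u (I • 1) = I • 1 ∧
        g = fromBlocks 1 X 0 1 * fromBlocks R 0 0 R⁻¹ * u := by
  have hZ : ((2 * I)⁻¹ • (moeb g (I • 1) - (moeb g (I • 1))ᴴ)).PosDef := posDef_im_moeb hg posDef_im_I_smul_one
  obtain ⟨X, R, hX, hR, hRu, hmem, hZ'⟩ := exists_transl_levi_moeb_I_eq hZ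
  refine ⟨X, R, fromBlocks R⁻¹ 0 0 R * fromBlocks 1 (-X) 0 1 * g, hX, hR, hRu, ?_, ?_, ?_⟩
  · refine mul_mem_UJ (mul_mem_UJ ((levi_mem_iff R⁻¹ R).2 ?_) ((transl_mem_iff (-X)).2 ?_)) hg
    · rw [conjTranspose_nonsing_inv, hR, nonsing_inv_mul R hRu]
    · rw [conjTranspose_neg, hX]
  · rw [moeb_mul (isUnit_det_denom hg posDef_im_I_smul_one), ← hZ', moeb_transl_mul_levi_I hRu, moeb_inv_section hRu]
  · rw [← Matrix.mul_assoc, transl_mul_levi_mul_inv hRu, Matrix.one_mul]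

/-- **The stabiliser equation**: for `g ∈ U(J)`, `g · i1 = i1 ↔ iA + B = −C + iD`. [cite: Shimura1997, §6.5] -/
theorem moeb_I_eq_I_iff {g : Matrix (l ⊕ l) (l ⊕ l) ℂ} (hg : gᴴ * Matrix.J l ℂ * g = Matrix.J l ℂ) :
    moeb g (I • 1) = I • 1 ↔
      I • g.toBlocks₁₁ + g.toBlocks₁₂ = -g.toBlocks₂₁ + I • g.toBlocks₂₂ := by
  have hd : IsUnit (denom g (I • (1 : Matrix l l ℂ))).det := isUnit_det_denom hg posDef_im_I_smul_one
  have hnum : num g (I • 1) = I • g.toBlocks₁₁ + g.toBlocks₁₂ := by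
    rw [num_def, Matrix.mul_smul, Matrix.mul_one]
  have hden : denom g (I • 1) = I • g.toBlocks₂₁ + g.toBlocks₂₂ := by
    rw [denom_def, Matrix.mul_smul, Matrix.mul_one]
  have hrhs : I • (1 : Matrix l l ℂ) * denom g (I • 1) = -g.toBlocks₂₁ + I • g.toBlocks₂₂ := by
    rw [hden, Matrix.mul_add, Matrix.smul_mul, Matrix.smul_mul, Matrix.one_mul, Matrix.one_mul, smul_smul, I_mul_I,
      neg_smul, one_smul]
  constructor
  · intro h
    rw [← hnum, ← moeb_mul_denom hd, h, hrhs]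
  · intro h
    have h' : num g (I • 1) = I • (1 : Matrix l l ℂ) * denom g (I • 1) := by rw [hnum, hrhs, h]
    rw [moeb_def, h', Matrix.mul_assoc, mul_nonsing_inv _ hd, Matrix.mul_one]

/-- The automorphy matrix at the base point: `denom g (i1) = iC + D`. [cite: Shimura1997, §6.5] -/
theorem denom_I (g : Matrix (l ⊕ l) (l ⊕ l) ℂ) : denom g (I • 1) = I • g.toBlocks₂₁ + g.toBlocks₂₂ := by
  rw [denom_def, Matrix.mul_smul, Matrix.mul_one]

/-- The rotations `(a b; −b a)` with `aᴴa + bᴴb = 1`, `aᴴb = bᴴa` lie in `U(J)` and fix `i1` (they exhaust `Stab(i1) ≅ U(n) × U(n)`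
via `(a + ib, a − ib)`; only this direction is recorded). [cite: Shimura1997, §6.5] -/
theorem rotation_mem_and_moeb_I {a b : Matrix l l ℂ} (h1 : aᴴ * a + bᴴ * b = 1) (h2 : aᴴ * b = bᴴ * a) :
    (fromBlocks a b (-b) a : Matrix (l ⊕ l) (l ⊕ l) ℂ)ᴴ * Matrix.J l ℂ * fromBlocks a b (-b) a = Matrix.J l ℂ ∧
      moeb (fromBlocks a b (-b) a) (I • 1) = I • 1 := by
  have hmem : (fromBlocks a b (-b) a : Matrix (l ⊕ l) (l ⊕ l) ℂ)ᴴ * Matrix.J l ℂ * fromBlocks a b (-b) a =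
      Matrix.J l ℂ := by
    rw [fromBlocks_conjTranspose_mul_J_mul_eq_iff]
    refine ⟨?_, ?_, ?_, ?_⟩
    · rw [conjTranspose_neg, Matrix.mul_neg, Matrix.neg_mul, h2]
    · rw [h2]
    · rw [conjTranspose_neg, Matrix.neg_mul, sub_neg_eq_add, h1]
    · rw [Matrix.mul_neg, sub_neg_eq_add, h1]
  refine ⟨hmem, (moeb_I_eq_I_iff hmem).2 ?_⟩
  rw [toBlocks_fromBlocks₁₁, toBlocks_fromBlocks₁₂, toBlocks_fromBlocks₂₁, toBlocks_fromBlocks₂₂, neg_neg, add_comm]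

/-! ## 4. Continuity of the action -/

omit [DecidableEq l] in
/-- `Z ↦ denom P Z = CZ + D` is continuous. [cite: Shimura1997, §6.3] -/
theorem continuous_denom (P : Matrix (l ⊕ l) (l ⊕ l) ℂ) : Continuous fun Z : Matrix l l ℂ => denom P Z := by
  simp only [denom_def]
  exact (continuous_const.mul continuous_id).add continuous_const

omit [DecidableEq l] in
/-- `Z ↦ num P Z = AZ + B` is continuous. [cite: Shimura1997, §6.3] -/
theorem continuous_num (P : Matrix (l ⊕ l) (l ⊕ l) ℂ) : Continuous fun Z : Matrix l l ℂ => num P Z := by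
  simp only [num_def]
  exact (continuous_const.mul continuous_id).add continuous_const

/-- `Z ↦ det (denom P Z)` (the automorphy factor) is continuous. [cite: Shimura1997, §6.3] -/
theorem continuous_det_denom (P : Matrix (l ⊕ l) (l ⊕ l) ℂ) : Continuous fun Z : Matrix l l ℂ => (denom P Z).det :=
  (continuous_denom P).matrix_det

/-- Matrix inversion is continuous at every invertible complex matrix. [folklore] -/
theorem continuousAt_matrix_inv {M : Matrix l l ℂ} (hM : IsUnit M.det) : ContinuousAt (fun A : Matrix l l ℂ => A⁻¹) M := by
  have h1 : ContinuousAt (fun A : Matrix l l ℂ => Ring.inverse A.det) M := by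
    have hd : ContinuousAt Ring.inverse M.det := by
      rw [Ring.inverse_eq_inv']
      exact continuousAt_inv₀ hM.ne_zero
    exact hd.comp (continuous_id.matrix_det : Continuous fun A : Matrix l l ℂ => A.det).continuousAt
  have h2 : ContinuousAt (fun A : Matrix l l ℂ => A.adjugate) M :=
    (continuous_id.matrix_adjugate : Continuous fun A : Matrix l l ℂ => A.adjugate).continuousAt
  exact h1.smul h2

/-- **`Z ↦ g·Z` is continuous on the tube** for `g ∈ U(J)`. [cite: Shimura1997, §6.3] -/
theorem continuousOn_moeb {P : Matrix (l ⊕ l) (l ⊕ l) ℂ} (hP : Pᴴ * Matrix.J l ℂ * P = Matrix.J l ℂ) :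
    ContinuousOn (fun Z : Matrix l l ℂ => moeb P Z) {Z | ((2 * I)⁻¹ • (Z - Zᴴ)).PosDef} := by
  intro Z hZ
  have h1 : ContinuousAt (fun W : Matrix l l ℂ => (denom P W)⁻¹) Z :=
    (continuousAt_matrix_inv (isUnit_det_denom hP hZ)).comp (continuous_denom P).continuousAt
  exact ((continuous_num P).continuousAt.mul h1).continuousWithinAt

/-- `Z ↦ g·Z` is continuous on `hermUpperHalfSpace n` for `g ∈ U(J)`. [cite: KudlaRapoport2013, §7 (p. 31)] -/
theorem continuousOn_moeb_hermUpperHalfSpace {n : ℕ} {P : Matrix (Fin n ⊕ Fin n) (Fin n ⊕ Fin n) ℂ}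
    (hP : Pᴴ * Matrix.J (Fin n) ℂ * P = Matrix.J (Fin n) ℂ) :
    ContinuousOn (fun Z => moeb P Z) (hermUpperHalfSpace n) :=
  continuousOn_moeb hP

/-- `Z ↦ g·Z` maps `hermUpperHalfSpace n` to itself (`MapsTo` form, Hol-2a (C)'s `hγ`). [cite: KudlaRapoport2013, §7 (p. 31)] -/
theorem mapsTo_moeb_hermUpperHalfSpace {n : ℕ} {P : Matrix (Fin n ⊕ Fin n) (Fin n ⊕ Fin n) ℂ}
    (hP : Pᴴ * Matrix.J (Fin n) ℂ * P = Matrix.J (Fin n) ℂ) :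
    MapsTo (fun Z => moeb P Z) (hermUpperHalfSpace n) (hermUpperHalfSpace n) :=
  fun _ hZ => moeb_mem_hermUpperHalfSpace hP hZ

end Summit.HodgeConjecture.HodgeConjecture.Cruxes.HLiu418.K2LiuHermitianTubeAction
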